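import Literature.Geometry.Riemannian.AlmostNonnegativeCurvatureSmoothing
import Literature.Topology.FourManifolds.ComplexProjectiveSpace
import HarnessLib

/-!
# Hamilton 1986, Thm. 1.3: closed 4-manifolds with NON-NEGATIVE curvature operator — the simply
connected and homotopy-sphere cases (named fact)

Topic `Literature/Geometry/Riemannian`, family `spc4`. Companion of
`hamilton_positiveCurvatureOperator_classification_four` (`HamiltonPCOClassification.lean`,
Hamilton 1986 Thm. 1.1, positive curvature operator ⇒ `S⁴` or `RP⁴`). Consumer: route
`AngleDefectCertificates` of `SmoothPoincare4` (BCRW branch: an `Rm ≥ 0` metric on a certified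
homotopy 4-sphere ⇒ `S⁴`) and the Euclidean `CBB(0)` variant of `stmt-SmoothPoincare4-7224`.
Source read, verbatim (R. S. Hamilton, *Four-manifolds with positive curvature operator*,
J. Differential Geom. 24 (1986) 153–179, pp. 153–154):

* p. 153: "We say the manifold has a positive curvature operator if `Rm(φ, φ) > 0` for all
  two-forms `φ ≠ 0`, and a nonnegative curvature operator if `Rm(φ, φ) ≥ 0` for all `φ`. These
  results extend to the case of nonnegative curvature."
* p. 154: "**1.3. Theorem.** A compact four-manifold with nonnegative curvature operator is
  diffeomorphic to a quotient of one of the spaces `S⁴` or `ℂP²` or `S³ × R¹` or `S² × S²` or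
  `S² × R²` or `R⁴` by a [finite] group of fixed point free isometries in the standard metric.
  The only quotient of `S⁴` is `RP⁴`, and there are no quotients of the complex projective space
  `ℂP²`. The quotients of `S³ × R¹` include `L³_{pq} × S¹` […] The quotients of `S² × S²` include
  `S² × RP²` and `RP² × RP²` and another space where `Z₂` acts on `S² × S²` as the antipodal map
  on each factor simultaneously. The quotients of `S² × R²` include `RP² × T²`, `S² × K²`, […] The
  quotients of `R⁴` give the torus `T⁴` and all the other flat four-manifolds."
  (Thm. 1.2 of the paper is the three-dimensional statement for `Ric ≥ 0`.)

## What is vendored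

The printed theorem is a classification by quotients `X/Γ` of six model geometries; the tree has
no vocabulary for "quotient of a model space by a group of fixed-point-free isometries", so the
named fact records its two consequences for SIMPLY CONNECTED manifolds, which need none:

* (a) a closed simply connected smooth 4-manifold with a `C^∞` Riemannian metric of nonnegative
  curvature operator is diffeomorphic to `S⁴`, to `ℂP²` or to `S² × S²` — a compact quotient `X/Γ`
  with `X ∈ {S³ × ℝ, S² × ℝ², ℝ⁴}` has `π₁ = Γ` infinite (the model is non-compact and simply
  connected), and the proper quotients of `S⁴`, `S² × S²` have `π₁ = Γ ≠ 1`; so for `π₁(M) = 1`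
  the theorem leaves `Γ = 1` and `X ∈ {S⁴, ℂP², S² × S²}`;
* (b) if moreover `M` is homotopy equivalent to `S⁴` then `M` is diffeomorphic to `S⁴`
  (`H₂(ℂP²) = ℤ`, `H₂(S² × S²) = ℤ²`, `H₂(S⁴) = 0`; a homotopy equivalence to `S⁴` also gives
  `π₁ = 1`).

Both are corollaries of Thm. 1.3 by covering-space theory and the homology of the models, at least
as weak as the printed statement (in (b) the binder `[SimplyConnectedSpace M]` is redundant given the
homotopy equivalence to `S⁴`; it is kept, which only weakens the statement). The curvature
hypothesis is the tree's EXISTING predicate `HasNonnegativeCurvatureOperator g`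
(`AlmostNonnegativeCurvatureSmoothing.lean`: `g.HasCurvatureOperatorGe 0`, i.e. for every
Levi-Civita connection `cov` of `g`, `Rm(φ, φ) = Σ_{a,b} Rm(Xₐ, Yₐ, Y_b, X_b) ≥ 0` for every finite
family of pairs, `hasCurvatureOperatorGeWith_zero_iff`) — Hamilton's p. 153 definition in the frame
form of `curvatureOperatorForm`, and the conclusion predicate of the tree's
`BamlerCabezasRivasWilking2019_cor3_nonnegativeCurvatureOperator`, so the two facts compose. The models:
the standard `S⁴ ⊂ ℝ⁵` (Mathlib sphere manifold), the tree's `ComplexProjectivePlane`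
(`Topology/FourManifolds/ComplexProjectiveSpace`, charted on `ℝ⁴`), and `S² × S²` as the product
manifold on `(𝓡 2).prod (𝓡 2)` (as in `NoExoticSphereTwoProdConjecture`).

Not here: the discharge (XL: Ricci flow with the strong maximum principle for the curvature ODE
and the holonomy/de Rham splitting, §§2–10 of the paper), the general `X/Γ` classification, the
three-dimensional Thm. 1.2.

## References

* [Hamilton1986] R. S. Hamilton, J. Differential Geom. 24 (1986) 153–179: definition p. 153,
  Thm. 1.3 and the list of quotients, p. 154.
-/

noncomputable section

open Set
open scoped Manifold ContDiff

namespace Literature.Geometry.Riemannian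

open Literature.Geometry.Lorentzian (PseudoRiemannianMetric)
open Literature.Geometry.Lorentzian.PseudoRiemannianMetric

/-- Local notation: the standard `4`-sphere. -/
local notation "𝕊⁴" => (Metric.sphere (0 : EuclideanSpace ℝ (Fin 5)) 1)
/-- Local notation: the standard `2`-sphere. -/
local notation "𝕊²" => (Metric.sphere (0 : EuclideanSpace ℝ (Fin 3)) 1)

section Nonneg

variable {E : Type*} [NormedAddCommGroup E] [NormedSpace ℝ E] {H : Type*} [TopologicalSpace H]
  {I : ModelWithCorners ℝ E H} {M : Type*} [TopologicalSpace M] [ChartedSpace H M]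
  [IsManifold I ∞ M] {n : ℕ∞ω}

variable {g : PseudoRiemannianMetric I n E (TangentSpace I : M → Type _)}
  {cov : CovariantDerivative I E (TangentSpace I : M → Type _)}

/-- A positive curvature operator is nonnegative on every NON-DEGENERATE 2-vector (the degenerate
ones, `φ♭ = 0`, are not constrained by `HasPositiveCurvatureOperatorWith`). [cite: Hamilton1986, §1, p. 153] -/
theorem _root_.Literature.Geometry.Lorentzian.PseudoRiemannianMetric.HasPositiveCurvatureOperatorWith.nonneg_of_ne
    (h : g.HasPositiveCurvatureOperatorWith cov) (x : M) {m : ℕ} (X Y : Fin m → TangentSpace I x)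
    (hXY : ∃ v w : TangentSpace I x, g.bivectorForm x X Y v w ≠ 0) :
    0 ≤ g.curvatureOperatorForm cov x X Y :=
  (h x m X Y hXY).le

/-- `Rm ≥ 0` (the tree's `HasNonnegativeCurvatureOperator`) unfolded at a Levi-Civita connection:
`0 ≤ Rm(φ, φ)` for every 2-vector. [cite: Hamilton1986, §1, p. 153] -/
theorem _root_.Literature.Geometry.Lorentzian.PseudoRiemannianMetric.HasNonnegativeCurvatureOperator.curvatureOperatorForm_nonneg
    [FiniteDimensional ℝ E] [CompleteSpace E] (h : g.HasNonnegativeCurvatureOperator)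
    (hcov : g.IsLeviCivita cov) (x : M) {m : ℕ} (X Y : Fin m → TangentSpace I x) :
    0 ≤ g.curvatureOperatorForm cov x X Y :=
  hasCurvatureOperatorGeWith_zero_iff.mp (h cov hcov) x m X Y

end Nonneg

/-- NAMED FACT (**Hamilton 1986, Thm. 1.3, p. 154** — "A compact four-manifold with nonnegative
curvature operator is diffeomorphic to a quotient of one of the spaces `S⁴` or `ℂP²` or `S³ × R¹`
or `S² × S²` or `S² × R²` or `R⁴` by a group of fixed point free isometries in the standard metric.
The only quotient of `S⁴` is `RP⁴`, and there are no quotients of the complex projective space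
`ℂP²`" — in its two simply connected consequences): for `M : Type` a compact, Hausdorff, second
countable, simply connected `C^∞` 4-manifold on `ℝ⁴` carrying a `C^∞` Riemannian metric of
nonnegative curvature operator (`HasNonnegativeCurvatureOperator`),
(a) `M` is diffeomorphic to the standard `S⁴`, to `ℂℙ²` (`ComplexProjectivePlane`) or to `S² × S²`
(product manifold on `(𝓡 2).prod (𝓡 2)`); and (b) if `M` is homotopy equivalent to `S⁴` then `M`
is diffeomorphic to `S⁴`. (From the printed classification: compact quotients of the non-compact
models and proper quotients of `S⁴`, `S² × S²` are not simply connected; `ℂP²`, `S² × S²` are not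
homotopy 4-spheres, `H₂ ≠ 0`.) Users take `(h : hamilton1986_nonnegCurvatureOperator_four)`.
[cite: Hamilton1986, §1, Thm. 1.3 and the list of quotients (p. 154); definition p. 153] -/
def hamilton1986_nonnegCurvatureOperator_four : Prop :=
  (∀ (M : Type) [TopologicalSpace M] [T2Space M] [SecondCountableTopology M] [CompactSpace M]
      [ChartedSpace (EuclideanSpace ℝ (Fin 4)) M] [IsManifold (𝓡 4) ∞ M] [SimplyConnectedSpace M],
      (∃ g : PseudoRiemannianMetric (𝓡 4) ∞ (EuclideanSpace ℝ (Fin 4)) (TangentSpace (𝓡 4) : M → Type _),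
          g.IsRiemannian ∧ g.HasNonnegativeCurvatureOperator) →
        Nonempty (M ≃ₘ⟮𝓡 4, 𝓡 4⟯ 𝕊⁴) ∨
          Nonempty (M ≃ₘ⟮𝓡 4, 𝓡 4⟯ Literature.Topology.FourManifolds.ComplexProjectivePlane) ∨
            Nonempty (M ≃ₘ⟮𝓡 4, (𝓡 2).prod (𝓡 2)⟯ (𝕊² × 𝕊²))) ∧
    ∀ (M : Type) [TopologicalSpace M] [T2Space M] [SecondCountableTopology M] [CompactSpace M]
      [ChartedSpace (EuclideanSpace ℝ (Fin 4)) M] [IsManifold (𝓡 4) ∞ M] [SimplyConnectedSpace M],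
      Nonempty (ContinuousMap.HomotopyEquiv M 𝕊⁴) →
      (∃ g : PseudoRiemannianMetric (𝓡 4) ∞ (EuclideanSpace ℝ (Fin 4)) (TangentSpace (𝓡 4) : M → Type _),
          g.IsRiemannian ∧ g.HasNonnegativeCurvatureOperator) →
        Nonempty (M ≃ₘ⟮𝓡 4, 𝓡 4⟯ 𝕊⁴)

namespace hamilton1986_nonnegCurvatureOperator_four

/-- **(a) The simply connected case**: `S⁴`, `ℂℙ²` or `S² × S²`, projected from the fact.
[cite: Hamilton1986, §1, Thm. 1.3 (p. 154)] -/
theorem simplyConnected (h : hamilton1986_nonnegCurvatureOperator_four)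
    (M : Type) [TopologicalSpace M] [T2Space M] [SecondCountableTopology M] [CompactSpace M]
    [ChartedSpace (EuclideanSpace ℝ (Fin 4)) M] [IsManifold (𝓡 4) ∞ M] [SimplyConnectedSpace M]
    (hg : ∃ g : PseudoRiemannianMetric (𝓡 4) ∞ (EuclideanSpace ℝ (Fin 4)) (TangentSpace (𝓡 4) : M → Type _),
        g.IsRiemannian ∧ g.HasNonnegativeCurvatureOperator) :
    Nonempty (M ≃ₘ⟮𝓡 4, 𝓡 4⟯ 𝕊⁴) ∨
      Nonempty (M ≃ₘ⟮𝓡 4, 𝓡 4⟯ Literature.Topology.FourManifolds.ComplexProjectivePlane) ∨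
        Nonempty (M ≃ₘ⟮𝓡 4, (𝓡 2).prod (𝓡 2)⟯ (𝕊² × 𝕊²)) :=
  h.1 M hg

/-- **(b) Homotopy 4-spheres with `Rm ≥ 0` are standard**: a closed simply connected 4-manifold
homotopy equivalent to `S⁴` carrying a `C^∞` metric of nonnegative curvature operator is
diffeomorphic to `S⁴` (the BCRW/`CBB(0)` consumption shape). [cite: Hamilton1986, §1, Thm. 1.3 (p. 154)] -/
theorem sphere_of_homotopyEquiv (h : hamilton1986_nonnegCurvatureOperator_four)
    (M : Type) [TopologicalSpace M] [T2Space M] [SecondCountableTopology M] [CompactSpace M]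
    [ChartedSpace (EuclideanSpace ℝ (Fin 4)) M] [IsManifold (𝓡 4) ∞ M] [SimplyConnectedSpace M]
    (he : Nonempty (ContinuousMap.HomotopyEquiv M 𝕊⁴))
    (hg : ∃ g : PseudoRiemannianMetric (𝓡 4) ∞ (EuclideanSpace ℝ (Fin 4)) (TangentSpace (𝓡 4) : M → Type _),
        g.IsRiemannian ∧ g.HasNonnegativeCurvatureOperator) :
    Nonempty (M ≃ₘ⟮𝓡 4, 𝓡 4⟯ 𝕊⁴) :=
  h.2 M he hg

end hamilton1986_nonnegCurvatureOperator_four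

end Literature.Geometry.Riemannian

end
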